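import Literature.NumberTheory.DiophantineGeometry.PlaneCurveRationalPointProofs
import Literature.NumberTheory.DiophantineGeometry.PlaneSectionBookkeepingProofs
import HarnessLib

/-!
# From a good plane section to a rational point (Cafure–Matera 2006, proof of Thm. 5.4, last step)

Let `f ∈ 𝔽_q[X₁, …, Xₙ]` have total degree `δ` with `2δ⁴ < q`, and let
`θᵢ = aᵢ Y + ℓᵢ(X)` (`aᵢ ∈ 𝔽_q`, `ℓᵢ ∈ 𝔽_q[X]` of degree `≤ 1`) parametrise an `𝔽_q`-plane.
The plane section `Φ₀ = f(θ₁, …, θₙ) ∈ 𝔽_q[X][Y]` has total degree `≤ δ` and `Y^δ`-coefficient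
`f_δ(a)` (`PlaneSectionBookkeepingProofs`). If `f_δ(a) ≠ 0` and `Φ₀` is absolutely irreducible,
then `f_δ(a)⁻¹ Φ₀` is a monic plane model of degree `δ` to which the existence form of Weil's
estimate (`PlaneCurveRationalPointProofs`) applies since `δ + (δ-1)(δ-2)√q < q + 1`; a rational
zero `(u, v)` of `Φ₀` gives the rational zero `(θᵢ(u, v))ᵢ` of `f`
(`exists_eval_eq_zero_of_planeSection`). This is the concluding sentence of Cafure–Matera's proof
of Thm. 5.4 ("which implies that `H` has at least one `q`-rational point"), isolated from the
choice of the plane (effective Bertini theorem, Cor. 3.2/3.4), which is treated elsewhere.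

## References

* A. Cafure, G. Matera, Finite Fields Appl. 12 (2006) 155–185, proof of Thm. 5.4. [CafureMatera2006]
-/

noncomputable section

open scoped Classical Polynomial.Bivariate
open Polynomial

namespace Literature.NumberTheory.DiophantineGeometry

universe u

/-! ### From a good plane section to a rational point -/

section PlaneSection

variable {F : Type u} [Field F] {n : ℕ}

/-- **From an absolutely irreducible plane section to a rational point (Cafure–Matera 2006, proof
of Thm. 5.4, conclusion).** Let `K = 𝔽_q`, `f ∈ K[X₁, …, Xₙ]` of total degree `δ` with
`2δ⁴ < q`, and `θᵢ = aᵢ Y + ℓᵢ(X)` affine-linear (`deg ℓᵢ ≤ 1`) with `f_δ(a) ≠ 0` (`f_δ` the top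
homogeneous component). If the plane section `f(θ) ∈ K[X][Y]` is absolutely irreducible
(irreducible over an algebraically closed field `K̄ ⊇ K`), then `f` has a `K`-rational zero:
`f(θ)/f_δ(a)` is a monic plane model of degree `δ` and total degree `δ`, Weil's estimate in the
form `exists_evalEval_eq_zero_of_irreducible_map'` gives a rational zero `(u, v)` of `f(θ)` since
`δ + (δ-1)(δ-2)√q < q + 1`, and `(θᵢ(u, v))ᵢ` is a zero of `f`.
[cite: CafureMatera2006, proof of Thm. 5.4] -/
theorem exists_eval_eq_zero_of_planeSection [Fintype F] (f : MvPolynomial (Fin n) F)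
    {Kbar : Type*} [Field Kbar] [IsAlgClosed Kbar] (σ : F →+* Kbar)
    (a : Fin n → F) (ℓ : Fin n → F[X]) (hℓ : ∀ i, (ℓ i).natDegree ≤ 1)
    (ha : MvPolynomial.eval a (MvPolynomial.homogeneousComponent f.totalDegree f) ≠ 0)
    (hirr : Irreducible
      ((MvPolynomial.aeval (fun i ↦ C (C (a i)) * Y + C (ℓ i)) f).map (mapRingHom σ)))
    (hq : 2 * f.totalDegree ^ 4 < Fintype.card F) :
    ∃ x : Fin n → F, MvPolynomial.eval x f = 0 := by
  set δ := f.totalDegree with hδ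
  set θ : Fin n → F[X][Y] := fun i ↦ C (C (a i)) * Y + C (ℓ i) with hθ
  set Φ₀ : F[X][Y] := MvPolynomial.aeval θ f with hΦ₀
  set e : F := MvPolynomial.eval a (MvPolynomial.homogeneousComponent δ f) with he
  have hcoeff : Φ₀.coeff δ = C e := coeff_aeval_affine_totalDegree f a ℓ
  have hdegle : Φ₀.natDegree ≤ δ := natDegree_aeval_affine_le f a ℓ hℓ
  have hdeg : Φ₀.natDegree = δ :=
    le_antisymm hdegle (le_natDegree_of_ne_zero (by rw [hcoeff]; exact C_ne_zero.2 ha))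
  have hlead : Φ₀.leadingCoeff = C e := by rw [leadingCoeff, hdeg, hcoeff]
  -- `δ ≥ 1`: a constant section is not irreducible
  have hδ1 : 1 ≤ δ := by
    by_contra h0
    have h0' : δ = 0 := by omega
    have hΦ₀C : Φ₀ = C (C e) := by
      rw [eq_C_of_natDegree_le_zero (hdeg.trans_le h0'.le), ← h0', hcoeff]
    have hunit : IsUnit (Φ₀.map (mapRingHom σ)) := by
      rw [hΦ₀C, Polynomial.map_C, coe_mapRingHom, Polynomial.map_C]
      exact isUnit_C.2 (isUnit_C.2 (IsUnit.mk0 _ ((map_ne_zero σ).2 ha)))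
    exact hirr.not_isUnit hunit
  -- the monic model `Φ = e⁻¹ Φ₀`
  set Φ : F[X][Y] := C (C e⁻¹) * Φ₀ with hΦ
  have hm : Φ.Monic := monic_C_mul_of_mul_leadingCoeff_eq_one (by
    rw [hlead, ← C_mul, inv_mul_cancel₀ ha, C_1])
  have hΦdeg : Φ.natDegree = δ := by
    rw [hΦ, natDegree_C_mul (C_ne_zero.2 (inv_ne_zero ha)), hdeg]
  have hdegΦ : ∀ i, i < Φ.natDegree → (Φ.coeff i).natDegree + i ≤ Φ.natDegree := by
    intro i hi
    rw [hΦdeg] at hi ⊢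
    rw [hΦ, coeff_C_mul]
    have h1 : (Φ₀.coeff i).natDegree ≤ δ - i := by
      rw [natDegree_le_iff_coeff_eq_zero]
      intro j hj
      exact coeff_coeff_aeval_affine_eq_zero f a ℓ hℓ i j (by omega)
    have h2 := (natDegree_C_mul_le (e⁻¹) (Φ₀.coeff i)).trans h1
    omega
  have hirrΦ : Irreducible (Φ.map (mapRingHom σ)) := by
    rw [hΦ, Polynomial.map_mul, map_C]
    refine (irreducible_isUnit_mul (isUnit_C.2 ?_)).2 hirr
    rw [coe_mapRingHom, map_C]
    exact isUnit_C.2 (IsUnit.mk0 _ (by simpa using ha))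
  have hnum : (Φ.natDegree : ℝ) + ((Φ.natDegree - 1) * (Φ.natDegree - 2) : ℕ) *
      √(Fintype.card F : ℝ) < (Fintype.card F : ℝ) + 1 := by
    rw [hΦdeg]
    exact cast_add_mul_sqrt_lt δ (Fintype.card F) hδ1 hq
  obtain ⟨u, v, huv⟩ :=
    AlgFunctionField.exists_evalEval_eq_zero_of_irreducible_map' hm hdegΦ σ hirrΦ hnum
  have h0 : Φ₀.evalEval u v = 0 := by
    rw [hΦ, evalEval_mul, evalEval_C, eval_C, mul_eq_zero] at huv
    exact huv.resolve_left (inv_ne_zero ha)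
  refine ⟨fun i ↦ (θ i).evalEval u v, ?_⟩
  have key : evalEvalRingHom u v (MvPolynomial.aeval θ f) =
      MvPolynomial.eval (fun i ↦ (θ i).evalEval u v) f := by
    rw [MvPolynomial.map_aeval]
    have hc : (evalEvalRingHom u v).comp (algebraMap F F[X][Y]) = RingHom.id F := by
      ext c
      simp [Polynomial.algebraMap_apply]
    rw [hc]
    rfl
  rw [← key]
  exact h0

end PlaneSection

end Literature.NumberTheory.DiophantineGeometry
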